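import Mathlib
import Literature.NumberTheory.LFunctions.Zhang2022.Section17Phi3minusSizes
import Literature.NumberTheory.LFunctions.Zhang2022.Section17Eq177Shift
import Literature.NumberTheory.LFunctions.Zhang2022.Section17U011MeanValue
import Literature.NumberTheory.LFunctions.Zhang2022.Section8Step8u016
import HarnessLib

/-!
# Zhang (2022) §17 (17.7), the `Ψ₁ → Ψ` extension on `𝔍(−1)` — preliminaries: the support and size of
# `X = BGNN` left of the critical line, and the series / head / tail of the reflected ratio `A(w,ψ)`

Topic `Literature/NumberTheory/LFunctions/Zhang2022` (Landau–Siegel audit tree; verdict-neutral).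
Y. Zhang, *Discrete mean estimates and the Landau–Siegel zero*, arXiv:2211.02515v1 (2022)
[Zhang2022LandauSiegel] — **an unrefereed manuscript under adjudication**; nothing here asserts or
denies its Theorems 1–2. DAG node `Z22:(17.7)` [Z22 p.97, tex L4785]: "Moving the segment `𝔍(−α)` to
`𝔍(−1)` and then extend the sum over `Ψ₁` to the sum over `Ψ` we obtain …" — the EXTENSION clause, which
§17 does not prove; the method is the one of (7.3)→(7.5) (§7 p.35, tex L1880–L1905: split the Dirichlet
series, move the tail far to one side where it is trivially small, move the entire head to `𝔍(0)`, then
Cauchy/Hölder with Lemma 3.3 and Proposition 2.1). This file collects the per-character INPUTS of that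
method for the reflected §17 integrand (every `ψ ∈ Ψ`, no Proposition 2.2):

with `𝔨₃*(s,ψ) = A(1−s,ψ)·X(s,ψ)` (`kfrak3Star_eq_ratio_mul_BGNN`), `A(w,ψ) = (L(w−β₁,ψ̄)/L(w,ψ̄))F(w,ψ̄)`,
`X(s,ψ) = B(s,ψ)G(s,ψ)N(s+β₂,ψ)N(s+β₃,ψ) = Σ_{n≤P} c(n)ψ(n)n^{−s}`, `c = (bχ)∗ν₁*` (tree
`Typed.Section17.BGNN_eq_sum_Icc`), and, for `Re w > 1`, `A(w,ψ) = L(a·ψ̄, w)`, `a = (ν·[≤D⁴]) ∗ κ̄₂`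
(`ratio_eq_LSeries`, from the tree's `step17_u017_le_holds`):

* `support_le_bigP_div`, `bchiConv_eq_zero_of_le` — `c(n) = 0` for `n ≥ N_b·N_ν`, and `N_b·N_ν ≤ P/D`
  (`D ≥ 18`, `𝓛 ≥ 4`);
* `norm_BGNN_le_left` / `norm_BGNN_le_mid` — `|X(s,ψ)| ≤ N^{σ}·S_c` on `Re s = −σ ≤ 0` (`N` any support
  bound) and `|X(s,ψ)| ≤ P^{1/2}·S_c` on `Re s ≥ −½`, `S_c = Σ_{n≤P}|c(n)|` (`sum_norm_bchiConv_le`: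
  `S_c ≤ K_ι⌊P⌋(m₃₆(log⌊P⌋)³⁶ + 1 + log⌊P⌋)`);
* `LSeries_sub_head_eq_tsum`, `norm_tsum_term_shift_le` — the head–tail split of `A(w,ψ)` at `M` and the
  tail bound `≤ (M+1)^{−(σ−½)}·C_ϱΣ_m m^{−5/4}` on `Re w = 1 + σ`, `σ ≥ ½`;
* `norm_headA_le`, `differentiable_headA` — the head `A_M(w,ψ)` is entire and `≤ C_ϱ·M·M^{1/4}` on
  `Re w ≥ 0`.

Theorems only; no definitions, no named facts; axioms standard. ZHANG-L discharge lane (WP16 placement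
W16-S5c (a), seat zl-w14-p1 g2), helper of zl-w16-p7 toward `Typed.Section17.Eq17_7 c′` (chain: these
preliminaries → the contour moves (`Section17Eq177ExtMoves`) → the Hölder core (`Section17Eq177ExtCore`,
`Eq177.norm_sum_PsiTwo_kfrak3Star_le`) → zl-w14-p2's `norm_sum_PsiTwo_weighted_kfrak3Star_le_of` →
zl-w16-p7's `eq17_7_of_ext`). WHAT THIS IS NOT: a claim about (17.7) as a whole, about Theorems 1–2 of the
source, or about Landau–Siegel zeros.

## References

* Y. Zhang, arXiv:2211.02515v1 (2022), §17 (17.7) p.97; §7 (7.3)–(7.5) pp.34–35, tex L1880–L1905.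
  [cite: Zhang2022LandauSiegel, §17 (17.7) p.97]
-/

noncomputable section

open Complex Real Set MeasureTheory intervalIntegral ComplexConjugate
open Literature.NumberTheory.LFunctions.Zhang2022.Skeleton
open Literature.NumberTheory.LFunctions.Zhang2022.Typed.Section17
open Literature.NumberTheory.LFunctions.Zhang2022.MeanSquareMajorant (tau majorantConst)
open scoped LSeries.notation

namespace Literature.NumberTheory.LFunctions.Zhang2022.Eq177

/-! ## Sizes of the parameters -/

section Sizes

variable {D : ℕ}

/-- `T = e^{𝓛^{1.1}} ≥ e^{𝓛} = D` (`𝓛 ≥ 1`, `D ≥ 1`). [cite: Zhang2022LandauSiegel, §6 p.28 (`T`)] -/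
theorem natCast_le_bigT (hD1 : 1 ≤ D) (hℓ1 : 1 ≤ ell D) : (D : ℝ) ≤ bigT D := by
  have hD0 : (0 : ℝ) < D := by exact_mod_cast (by omega : 0 < D)
  have hDexp : (D : ℝ) = Real.exp (ell D) := by rw [ell, Real.exp_log hD0]
  rw [hDexp, bigT, Real.exp_le_exp]
  exact Real.self_le_rpow_of_one_le hℓ1 (by norm_num)

/-- `T¹⁰ ≤ P` for `𝓛 ≥ 2` (`10𝓛^{1.1} ≤ 10𝓛² ≤ 𝓛⁹`). [cite: Zhang2022LandauSiegel, §2 (2.6); §6 p.28] -/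
theorem bigT_pow_ten_le_bigP (hℓ : 2 ≤ ell D) : bigT D ^ 10 ≤ bigP D := by
  have hℓ1 : 1 ≤ ell D := by linarith
  rw [bigT, ← Real.exp_nat_mul, bigP, Real.exp_le_exp]
  have h11 : ell D ^ (1.1 : ℝ) ≤ ell D ^ 2 := by
    have h := Real.rpow_le_rpow_of_exponent_le hℓ1 (by norm_num : (1.1 : ℝ) ≤ 2)
    rwa [Real.rpow_two] at h
  have h2 : (10 : ℝ) * ell D ^ 2 ≤ ell D ^ 9 := by
    have h7 : (2 : ℝ) ^ 7 ≤ ell D ^ 7 := pow_le_pow_left₀ (by norm_num) hℓ 7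
    have : ell D ^ 9 = ell D ^ 2 * ell D ^ 7 := by ring
    nlinarith [pow_pos (by linarith : (0 : ℝ) < ell D) 2]
  push_cast
  linarith

/-- **The support of `c = (bχ)∗ν₁*` lies below `P/D`**: for `D ≥ 18` with `𝓛 ≥ 4`,
`⌈P^{1/2}·max(P₂,P₃)⌉·⌈4(D⁴+1)T⁴⌉ ≤ P/D` (`P^{1/2}max(P₂,P₃) = PT⁻¹⁰`, `4(D⁴+1)T⁴ + 1 ≤ 9D⁴T⁴`,
`T ≥ D`, `18D⁴PT⁻⁶ ≤ 18PD⁻² ≤ P/D`). [cite: Zhang2022LandauSiegel, §17 (17.8) p.98 ("`n < PT⁻²`")] -/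
theorem support_le_bigP_div (hD : 18 ≤ D) (hℓ : 4 ≤ ell D) :
    ((⌈bigP D ^ (1 / 2 : ℝ) * max (Skeleton.P2 D) (Skeleton.P3 D)⌉₊ *
        ⌈4 * ((D : ℝ) ^ 4 + 1) * bigT D ^ 4⌉₊ : ℕ) : ℝ) ≤ bigP D / D := by
  have hℓ1 : 1 ≤ ell D := by linarith
  have hD1 : 1 ≤ D := le_trans (by norm_num) hD
  have hDr : (18 : ℝ) ≤ D := by exact_mod_cast hD
  have hD0 : (0 : ℝ) < D := by linarith
  have hP : 0 < bigP D := Real.exp_pos _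
  have hT0 : 0 < bigT D := Real.exp_pos _
  have hDT : (D : ℝ) ≤ bigT D := natCast_le_bigT hD1 hℓ1
  have hT1 : 1 ≤ bigT D := le_trans (by exact_mod_cast hD1) hDT
  -- `N_b ≤ 2PT⁻¹⁰`
  have hmax : max (Skeleton.P2 D) (Skeleton.P3 D) = Skeleton.P2 D :=
    max_eq_left (P3_le_P2_of_four_le hℓ)
  have hA : bigP D ^ (1 / 2 : ℝ) * Skeleton.P2 D = bigP D / bigT D ^ 10 := by
    rw [Skeleton.P2, show (0.5 : ℝ) = 1 / 2 by norm_num, mul_div_assoc', ← Real.rpow_add hP]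
    norm_num
  have hA1 : 1 ≤ bigP D / bigT D ^ 10 := by
    rw [le_div_iff₀ (pow_pos hT0 10), one_mul]; exact bigT_pow_ten_le_bigP (by linarith)
  have hNb : (⌈bigP D ^ (1 / 2 : ℝ) * max (Skeleton.P2 D) (Skeleton.P3 D)⌉₊ : ℝ) ≤
      2 * (bigP D / bigT D ^ 10) := by
    rw [hmax, hA]
    have := (Nat.ceil_lt_add_one (by positivity : 0 ≤ bigP D / bigT D ^ 10)).le
    linarith
  -- `N_ν ≤ 9D⁴T⁴`
  have hNν : (⌈4 * ((D : ℝ) ^ 4 + 1) * bigT D ^ 4⌉₊ : ℝ) ≤ 9 * (D : ℝ) ^ 4 * bigT D ^ 4 := by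
    have h1 := (Nat.ceil_lt_add_one (by positivity : 0 ≤ 4 * ((D : ℝ) ^ 4 + 1) * bigT D ^ 4)).le
    have hD4 : (1 : ℝ) ≤ (D : ℝ) ^ 4 := one_le_pow₀ (by linarith)
    have hT4 : (1 : ℝ) ≤ bigT D ^ 4 := one_le_pow₀ hT1
    nlinarith [mul_nonneg (sub_nonneg.mpr hD4) (sub_nonneg.mpr hT4)]
  -- combine: `18D⁵ ≤ D⁶ ≤ T⁶`
  push_cast
  have hT6 : (D : ℝ) ^ 6 ≤ bigT D ^ 6 := pow_le_pow_left₀ hD0.le hDT 6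
  have h18 : 18 * (D : ℝ) ^ 5 ≤ bigT D ^ 6 := by
    have : (D : ℝ) ^ 6 = (D : ℝ) ^ 5 * D := by ring
    nlinarith [pow_pos hD0 5]
  have key : 2 * (bigP D / bigT D ^ 10) * (9 * (D : ℝ) ^ 4 * bigT D ^ 4) ≤ bigP D / D := by
    rw [show 2 * (bigP D / bigT D ^ 10) * (9 * (D : ℝ) ^ 4 * bigT D ^ 4) =
        (18 * (D : ℝ) ^ 4 * bigT D ^ 4 * bigP D) / bigT D ^ 10 by ring,
      div_le_div_iff₀ (pow_pos hT0 10) hD0]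
    calc 18 * (D : ℝ) ^ 4 * bigT D ^ 4 * bigP D * D
        = bigP D * bigT D ^ 4 * (18 * (D : ℝ) ^ 5) := by ring
      _ ≤ bigP D * bigT D ^ 4 * bigT D ^ 6 := mul_le_mul_of_nonneg_left h18 (by positivity)
      _ = bigP D * bigT D ^ 10 := by ring
  calc (⌈bigP D ^ (1 / 2 : ℝ) * max (Skeleton.P2 D) (Skeleton.P3 D)⌉₊ : ℝ) *
        (⌈4 * ((D : ℝ) ^ 4 + 1) * bigT D ^ 4⌉₊ : ℝ)
      ≤ 2 * (bigP D / bigT D ^ 10) * (9 * (D : ℝ) ^ 4 * bigT D ^ 4) :=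
        mul_le_mul hNb hNν (Nat.cast_nonneg _) (by positivity)
    _ ≤ bigP D / D := key

end Sizes

/-! ## The polynomial `X = B·G·N·N` and its size left of the critical line -/

section Poly

variable (c' : ℝ) {D : ℕ} [NeZero D] (χ : DirichletCharacter ℂ D)

omit [NeZero D] in
/-- The coefficient `c = (bχ)∗ν₁*` vanishes from `N_b·N_ν` on. [cite: Zhang2022LandauSiegel, §17 (17.8) p.98] -/
theorem bchiConv_eq_zero_of_le {n : ℕ}
    (hn : ⌈bigP D ^ (1 / 2 : ℝ) * max (Skeleton.P2 D) (Skeleton.P3 D)⌉₊ *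
        ⌈4 * ((D : ℝ) ^ 4 + 1) * bigT D ^ 4⌉₊ ≤ n) :
    ((fun n => bcoef D n * χ (n : ZMod D)) ⍟ nuOneStar c' χ) n = 0 :=
  convolution_eq_zero_of_le (fun _ h => bcoef_mul_chi_eq_zero_of_le χ h)
    (fun _ h => nuOneStar_eq_zero_of_ceil_le c' χ h) hn

/-- **`|X(s,ψ)| ≤ N^{σ}·S_c` on `Re s = −σ ≤ 0`** for any `N` from which `c` vanishes
(`X = Σ_{n≤P}c(n)ψ(n)n^{−s}`, `|n^{−s}| = n^{σ} ≤ N^{σ}` on the support; `D ≥ 3`, `𝓛 ≥ 4`).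
[cite: Zhang2022LandauSiegel, §7 p.35 ("`A(𝐚₂;1−s,ψ̄) ≪ (PT⁻²)^σ`")] -/
theorem norm_BGNN_le_left (hD : 3 ≤ D) (hℓ : 4 ≤ ell D) (x : Chr D) {N : ℕ}
    (hN : ∀ n, N ≤ n → ((fun n => bcoef D n * χ (n : ZMod D)) ⍟ nuOneStar c' χ) n = 0)
    {s : ℂ} {σ : ℝ} (hσ : 0 ≤ σ) (hs : s.re = -σ) :
    ‖Bpoly χ x s * Gpoly χ x s * Nchar D (psiFn x) (s + beta2 c' D) *
        Nchar D (psiFn x) (s + beta3 c' D)‖ ≤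
      (N : ℝ) ^ σ * ∑ n ∈ Finset.Icc 1 ⌊bigP D⌋₊,
        ‖((fun n => bcoef D n * χ (n : ZMod D)) ⍟ nuOneStar c' χ) n‖ := by
  set c : ℕ → ℂ := (fun n => bcoef D n * χ (n : ZMod D)) ⍟ nuOneStar c' χ with hc
  rw [BGNN_eq_sum_Icc c' χ hD hℓ x s, Finset.mul_sum]
  refine (norm_sum_le _ _).trans (Finset.sum_le_sum fun n hn => ?_)
  have hn1 : 1 ≤ n := (Finset.mem_Icc.mp hn).1
  have hn0 : (0 : ℝ) < n := by exact_mod_cast hn1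
  rw [norm_mul, norm_mul, Complex.norm_natCast_cpow_of_pos hn1, Complex.neg_re, hs, neg_neg]
  by_cases hcn : c n = 0
  · rw [hc] at hcn; simp [hcn]; positivity
  · have hnN : n < N := by
      by_contra h; exact hcn (hN n (not_lt.mp h))
    have hψ : ‖x.ψ (n : ZMod x.p)‖ ≤ 1 := x.ψ.norm_le_one _
    have hnσ : (n : ℝ) ^ σ ≤ (N : ℝ) ^ σ :=
      Real.rpow_le_rpow hn0.le (by exact_mod_cast hnN.le) hσ
    calc ‖c n‖ * ‖x.ψ (n : ZMod x.p)‖ * (n : ℝ) ^ σ ≤ ‖c n‖ * 1 * (N : ℝ) ^ σ := by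
          gcongr
      _ = (N : ℝ) ^ σ * ‖c n‖ := by ring

/-- **`|X(s,ψ)| ≤ P^{1/2}·S_c` on `Re s ≥ −½`** (`|n^{−s}| ≤ n^{1/2} ≤ P^{1/2}` for `1 ≤ n ≤ P`;
`D ≥ 3`, `𝓛 ≥ 4`). [cite: Zhang2022LandauSiegel, §7 p.35] -/
theorem norm_BGNN_le_mid (hD : 3 ≤ D) (hℓ : 4 ≤ ell D) (x : Chr D) {s : ℂ}
    (hs1 : -(1 / 2) ≤ s.re) :
    ‖Bpoly χ x s * Gpoly χ x s * Nchar D (psiFn x) (s + beta2 c' D) *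
        Nchar D (psiFn x) (s + beta3 c' D)‖ ≤
      bigP D ^ (1 / 2 : ℝ) * ∑ n ∈ Finset.Icc 1 ⌊bigP D⌋₊,
        ‖((fun n => bcoef D n * χ (n : ZMod D)) ⍟ nuOneStar c' χ) n‖ := by
  set c : ℕ → ℂ := (fun n => bcoef D n * χ (n : ZMod D)) ⍟ nuOneStar c' χ with hc
  have hP : 0 < bigP D := Real.exp_pos _
  rw [BGNN_eq_sum_Icc c' χ hD hℓ x s, Finset.mul_sum]
  refine (norm_sum_le _ _).trans (Finset.sum_le_sum fun n hn => ?_)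
  obtain ⟨hn1, hnP⟩ := Finset.mem_Icc.mp hn
  have hn0 : (0 : ℝ) < n := by exact_mod_cast hn1
  have hnr : (1 : ℝ) ≤ n := by exact_mod_cast hn1
  have hnP' : (n : ℝ) ≤ bigP D := (Nat.cast_le.mpr hnP).trans (Nat.floor_le hP.le)
  rw [norm_mul, norm_mul, Complex.norm_natCast_cpow_of_pos hn1, Complex.neg_re]
  have hψ : ‖x.ψ (n : ZMod x.p)‖ ≤ 1 := x.ψ.norm_le_one _
  have hpow : (n : ℝ) ^ (-s.re) ≤ bigP D ^ (1 / 2 : ℝ) := by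
    calc (n : ℝ) ^ (-s.re) ≤ (n : ℝ) ^ (1 / 2 : ℝ) :=
          Real.rpow_le_rpow_of_exponent_le hnr (by linarith)
      _ ≤ bigP D ^ (1 / 2 : ℝ) := Real.rpow_le_rpow hn0.le hnP' (by norm_num)
  calc ‖c n‖ * ‖x.ψ (n : ZMod x.p)‖ * (n : ℝ) ^ (-s.re) ≤ ‖c n‖ * 1 * bigP D ^ (1 / 2 : ℝ) := by
        gcongr
    _ = bigP D ^ (1 / 2 : ℝ) * ‖c n‖ := by ring

omit [NeZero D] in
/-- **`S_c = Σ_{n≤P}|c(n)| ≤ K_ι·⌊P⌋·(majorantConst 36 12 (log⌊P⌋)³⁶ + 1 + log⌊P⌋)`** (`|c| ≤ K_ιτ₆`,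
`Phi3Minus.sum_norm_mul_rpow_le_of_tau` with `e = 0`; `log D ≥ 2`, `⌊P⌋ ≥ 2`).
[cite: Zhang2022LandauSiegel, §17 (17.8) p.98] -/
theorem sum_norm_bchiConv_le (hD : 2 ≤ Real.log D) (hP2 : 2 ≤ ⌊bigP D⌋₊) :
    ∑ n ∈ Finset.Icc 1 ⌊bigP D⌋₊, ‖((fun n => bcoef D n * χ (n : ZMod D)) ⍟ nuOneStar c' χ) n‖ ≤
      (1 + ‖iota2‖) * (‖iota3‖ + ‖iota4‖) * (⌊bigP D⌋₊ : ℝ) *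
        (majorantConst (6 ^ 2) (2 * 6) * Real.log ⌊bigP D⌋₊ ^ (6 ^ 2) + (1 + Real.log ⌊bigP D⌋₊)) := by
  have hK0 : 0 ≤ (1 + ‖iota2‖) * (‖iota3‖ + ‖iota4‖) := by positivity
  have h := Phi3Minus.sum_norm_mul_rpow_le_of_tau hK0
    (fun n hn => Phi3Minus.norm_bchiConv_le_tau c' χ hD n) (e := 0) (by norm_num)
    (M := ⌊bigP D⌋₊ + 1) (X := ⌊bigP D⌋₊) le_rfl hP2
  have hIcc : Finset.Icc 1 ⌊bigP D⌋₊ = Finset.Ico 1 (⌊bigP D⌋₊ + 1) := by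
    ext n; simp only [Finset.mem_Icc, Finset.mem_Ico]; omega
  rw [hIcc]
  refine le_trans (le_of_eq ?_) (h.trans (le_of_eq ?_))
  · refine Finset.sum_congr rfl fun n _ => ?_
    rw [Real.rpow_zero, mul_one]
  · rw [zero_add, Real.rpow_one]

end Poly

/-! ## The reflected ratio `A(w,ψ) = (L(w−β₁,ψ̄)/L(w,ψ̄))F(w,ψ̄)`: series, head and tail -/

section Ratio

variable (c' : ℝ) {D : ℕ} [NeZero D] (χ : DirichletCharacter ℂ D)

omit [NeZero D] in
/-- **`𝔨₃*(s,ψ) = A(1−s,ψ)·X(s,ψ)`** (regrouping of §17.u012). [cite: Zhang2022LandauSiegel, §17 u012 p.97] -/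
theorem kfrak3Star_eq_ratio_mul_BGNN (x : Chr D) (s : ℂ) :
    kfrak3Star c' χ x s =
      (DirichletCharacter.LFunction x.ψ⁻¹ (1 - s - beta1 c' D) /
          DirichletCharacter.LFunction x.ψ⁻¹ (1 - s) * FpolyBar χ x (1 - s)) *
        (Bpoly χ x s * Gpoly χ x s * Nchar D (psiFn x) (s + beta2 c' D) *
          Nchar D (psiFn x) (s + beta3 c' D)) := by
  unfold kfrak3Star; ring

omit [NeZero D] in
/-- The `a·ψ̄`-series as an `LSeries`: `Σ'_m a(m)ψ̄(m)m^{−w} = L(a·ψ̄, w)` (the `m = 0` term vanishes on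
both sides since `a(0) = 0`). [cite: Zhang2022LandauSiegel, §17 u017 p.97] -/
theorem tsum_eq_LSeries_aPsiBar (x : Chr D) (w : ℂ) :
    ∑' m : ℕ, (trunc (D ^ 4) (nu χ) ⍟ kappa2bar c' D) m * conj (x.ψ (m : ZMod x.p)) * (m : ℂ) ^ (-w) =
      LSeries (fun m => (trunc (D ^ 4) (nu χ) ⍟ kappa2bar c' D) m * conj (x.ψ (m : ZMod x.p))) w := by
  refine tsum_congr fun m => ?_
  rcases eq_or_ne m 0 with rfl | hm
  · simp [LSeries.term_zero, LSeries.convolution_map_zero]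
  · rw [LSeries.term_of_ne_zero hm, div_eq_mul_inv, Complex.cpow_neg]

omit [NeZero D] in
/-- **For `Re s < 0`, `A(1−s,ψ) = L(a·ψ̄, 1−s)`** (tree `step17_u017_le_holds`).
[cite: Zhang2022LandauSiegel, §17 u017 p.97] -/
theorem ratio_eq_LSeries (x : Chr D) {s : ℂ} (hs : s.re < 0) :
    DirichletCharacter.LFunction x.ψ⁻¹ (1 - s - beta1 c' D) /
        DirichletCharacter.LFunction x.ψ⁻¹ (1 - s) * FpolyBar χ x (1 - s) =
      LSeries (fun m => (trunc (D ^ 4) (nu χ) ⍟ kappa2bar c' D) m * conj (x.ψ (m : ZMod x.p)))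
        (1 - s) := by
  rw [step17_u017_le_holds c' (χ := χ) x s hs, tsum_eq_LSeries_aPsiBar]

omit [NeZero D] in
/-- The head as a sum of `LSeries.term`s over `range (M+1)`. [folklore] -/
private theorem head_eq_sum_range_term' (f : ℕ → ℂ) (M : ℕ) (w : ℂ) :
    ∑ m ∈ Finset.Icc 1 M, f m * (m : ℂ) ^ (-w) = ∑ m ∈ Finset.range (M + 1), LSeries.term f w m := by
  rw [Finset.range_eq_Ico, Finset.sum_eq_sum_Ico_succ_bot (Nat.succ_pos M), LSeries.term_zero,
    zero_add]
  refine Finset.sum_congr (by ext n; simp only [Finset.mem_Ico, Finset.mem_Icc]; omega) fun n hn => ?_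
  have hn0 : n ≠ 0 := by have := (Finset.mem_Icc.mp hn).1; omega
  rw [LSeries.term_of_ne_zero hn0, div_eq_mul_inv, Complex.cpow_neg]

omit [NeZero D] in
/-- **Head–tail split of `A(w,ψ)` on `Re w > 1`**: `L(a·ψ̄,w) − A_M(w,ψ) = Σ'_i term(i + M + 1)`.
[cite: Zhang2022LandauSiegel, §7 p.35 ("The sum over `m` is split into two sums")] -/
theorem LSeries_sub_head_eq_tsum (x : Chr D) (M : ℕ) {w : ℂ} (hw : 1 < w.re) :
    LSeries (fun m => (trunc (D ^ 4) (nu χ) ⍟ kappa2bar c' D) m * conj (x.ψ (m : ZMod x.p))) w -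
        ∑ m ∈ Finset.Icc 1 M,
          (trunc (D ^ 4) (nu χ) ⍟ kappa2bar c' D) m * conj (x.ψ (m : ZMod x.p)) * (m : ℂ) ^ (-w) =
      ∑' i : ℕ, LSeries.term
        (fun m => (trunc (D ^ 4) (nu χ) ⍟ kappa2bar c' D) m * conj (x.ψ (m : ZMod x.p))) w
          (i + (M + 1)) := by
  set f : ℕ → ℂ := fun m => (trunc (D ^ 4) (nu χ) ⍟ kappa2bar c' D) m * conj (x.ψ (m : ZMod x.p))
    with hf
  have hsum : LSeriesSummable f w := Phi3Minus.LSeriesSummable_varrhoLe_conj c' χ x hw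
  have hsplit := hsum.sum_add_tsum_nat_add (M + 1)
  rw [head_eq_sum_range_term' f M w, LSeries, ← hsplit]
  ring

/-- **A Dirichlet-series tail beyond `M` on `Re w = 1 + σ`, `σ ≥ ½`** (generic): if `|f(m)| ≤ Cm^{1/4}`
then `‖Σ'_i term(f, w, i+M+1)‖ ≤ (M+1)^{−(σ−½)}·C·Σ_m m^{−5/4}` (`m^{−1−σ} = m^{−3/2}·m^{−(σ−½)} ≤
m^{−3/2}(M+1)^{−(σ−½)}` for `m ≥ M+1`; `Phi3Minus.tsum_norm_term_le_of_rpow` at `σ = 3/2`). Used for the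
tail of `A(w,ψ) = Σ_m a(m)ψ̄(m)m^{−w}`, `|a(m)ψ̄(m)| ≤ C_ϱm^{1/4}` (`Phi3Minus.exists_norm_varrhoLe_le_rpow`).
[cite: Zhang2022LandauSiegel, §7 p.35 ("`Σ_{m≥P²} … ≪ P^{2(1−σ)}𝓛^c`")] -/
theorem norm_tsum_term_shift_le (f : ℕ → ℂ) {C : ℝ}
    (hfa : ∀ m : ℕ, ‖f m‖ ≤ C * (m : ℝ) ^ (1 / 4 : ℝ)) (M : ℕ)
    {w : ℂ} {σ : ℝ} (hσ : 1 / 2 ≤ σ) (hw : w.re = 1 + σ) :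
    ‖∑' i : ℕ, LSeries.term f w (i + (M + 1))‖ ≤
      ((M + 1 : ℕ) : ℝ) ^ (-(σ - 1 / 2)) * (C * ∑' m : ℕ, (m : ℝ) ^ (-(5 / 4 : ℝ))) := by
  obtain ⟨hsum32, htsum32⟩ := Phi3Minus.tsum_norm_term_le_of_rpow hfa
  have hM1 : (0 : ℝ) < ((M + 1 : ℕ) : ℝ) := by positivity
  have hq0 : 0 ≤ ((M + 1 : ℕ) : ℝ) ^ (-(σ - 1 / 2)) := by positivity
  -- termwise comparison with the `σ = 3/2` terms
  have h32 : ((3 / 2 : ℂ)).re = 3 / 2 := by norm_num [Complex.div_re]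
  have hterm : ∀ i : ℕ, ‖LSeries.term f w (i + (M + 1))‖ ≤
      ((M + 1 : ℕ) : ℝ) ^ (-(σ - 1 / 2)) * ‖LSeries.term f (3 / 2 : ℂ) (i + (M + 1))‖ := by
    intro i
    have hn0 : i + (M + 1) ≠ 0 := by omega
    have hnr : (0 : ℝ) < ((i + (M + 1) : ℕ) : ℝ) := by positivity
    have hMn : ((M + 1 : ℕ) : ℝ) ≤ ((i + (M + 1) : ℕ) : ℝ) := by
      exact_mod_cast (by omega : M + 1 ≤ i + (M + 1))
    rw [LSeries.norm_term_eq, if_neg hn0, LSeries.norm_term_eq, if_neg hn0, hw, h32]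
    have e1 : ((i + (M + 1) : ℕ) : ℝ) ^ (1 + σ) =
        ((i + (M + 1) : ℕ) : ℝ) ^ (3 / 2 : ℝ) * ((i + (M + 1) : ℕ) : ℝ) ^ (σ - 1 / 2) := by
      rw [show (1 : ℝ) + σ = 3 / 2 + (σ - 1 / 2) by ring, Real.rpow_add hnr]
    have e2 : (((i + (M + 1) : ℕ) : ℝ) ^ (σ - 1 / 2))⁻¹ ≤ ((M + 1 : ℕ) : ℝ) ^ (-(σ - 1 / 2)) := by
      rw [Real.rpow_neg hM1.le]
      exact inv_anti₀ (Real.rpow_pos_of_pos hM1 _) (Real.rpow_le_rpow hM1.le hMn (by linarith))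
    have hf0 : 0 ≤ ‖f (i + (M + 1))‖ / ((i + (M + 1) : ℕ) : ℝ) ^ (3 / 2 : ℝ) := by positivity
    calc ‖f (i + (M + 1))‖ / ((i + (M + 1) : ℕ) : ℝ) ^ (1 + σ)
        = ‖f (i + (M + 1))‖ / ((i + (M + 1) : ℕ) : ℝ) ^ (3 / 2 : ℝ) *
            (((i + (M + 1) : ℕ) : ℝ) ^ (σ - 1 / 2))⁻¹ := by
          rw [e1, div_mul_eq_div_div, div_eq_mul_inv]
      _ ≤ ‖f (i + (M + 1))‖ / ((i + (M + 1) : ℕ) : ℝ) ^ (3 / 2 : ℝ) *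
            ((M + 1 : ℕ) : ℝ) ^ (-(σ - 1 / 2)) := mul_le_mul_of_nonneg_left e2 hf0
      _ = ((M + 1 : ℕ) : ℝ) ^ (-(σ - 1 / 2)) *
            (‖f (i + (M + 1))‖ / ((i + (M + 1) : ℕ) : ℝ) ^ (3 / 2 : ℝ)) := mul_comm _ _
  -- summability of the shifted `3/2`-norms
  have hg32 : Summable fun n : ℕ => ‖LSeries.term f (3 / 2 : ℂ) n‖ := summable_norm_iff.mpr hsum32
  have hnorm32 : Summable fun i : ℕ => ‖LSeries.term f (3 / 2 : ℂ) (i + (M + 1))‖ := by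
    have h := (summable_nat_add_iff (f := fun n : ℕ => ‖LSeries.term f (3 / 2 : ℂ) n‖) (M + 1)).mpr hg32
    exact h
  have hmaj : Summable fun i : ℕ =>
      ((M + 1 : ℕ) : ℝ) ^ (-(σ - 1 / 2)) * ‖LSeries.term f (3 / 2 : ℂ) (i + (M + 1))‖ :=
    hnorm32.mul_left _
  have hnormw : Summable fun i : ℕ => ‖LSeries.term f w (i + (M + 1))‖ :=
    Summable.of_nonneg_of_le (fun _ => norm_nonneg _) hterm hmaj
  have hshift_le : ∑' i : ℕ, ‖LSeries.term f (3 / 2 : ℂ) (i + (M + 1))‖ ≤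
      ∑' m : ℕ, ‖LSeries.term f (3 / 2 : ℂ) m‖ := by
    rw [← hg32.sum_add_tsum_nat_add (M + 1)]
    linarith [Finset.sum_nonneg (fun i (_ : i ∈ Finset.range (M + 1)) =>
      norm_nonneg (LSeries.term f (3 / 2 : ℂ) i))]
  calc ‖∑' i : ℕ, LSeries.term f w (i + (M + 1))‖
      ≤ ∑' i : ℕ, ‖LSeries.term f w (i + (M + 1))‖ := norm_tsum_le_tsum_norm hnormw
    _ ≤ ∑' i : ℕ, ((M + 1 : ℕ) : ℝ) ^ (-(σ - 1 / 2)) * ‖LSeries.term f (3 / 2 : ℂ) (i + (M + 1))‖ :=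
        Summable.tsum_le_tsum hterm hnormw hmaj
    _ = ((M + 1 : ℕ) : ℝ) ^ (-(σ - 1 / 2)) * ∑' i : ℕ, ‖LSeries.term f (3 / 2 : ℂ) (i + (M + 1))‖ :=
        tsum_mul_left
    _ ≤ ((M + 1 : ℕ) : ℝ) ^ (-(σ - 1 / 2)) * ∑' m : ℕ, ‖LSeries.term f (3 / 2 : ℂ) m‖ :=
        mul_le_mul_of_nonneg_left hshift_le hq0
    _ ≤ ((M + 1 : ℕ) : ℝ) ^ (-(σ - 1 / 2)) * (C * ∑' m : ℕ, (m : ℝ) ^ (-(5 / 4 : ℝ))) :=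
        mul_le_mul_of_nonneg_left htsum32 hq0

omit [NeZero D] in
/-- The coefficients `a(m)ψ̄(m)` of `A(w,ψ)` satisfy `|a(m)ψ̄(m)| ≤ C_ϱm^{1/4}` with the absolute `C_ϱ` of
`Phi3Minus.exists_norm_varrhoLe_le_rpow`. [cite: Zhang2022LandauSiegel, §17 u017 p.97] -/
theorem norm_aPsiBar_le (x : Chr D) {C : ℝ}
    (hC : ∀ m : ℕ, ‖(trunc (D ^ 4) (nu χ) ⍟ kappa2bar c' D) m‖ ≤ C * (m : ℝ) ^ (1 / 4 : ℝ)) (m : ℕ) :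
    ‖(trunc (D ^ 4) (nu χ) ⍟ kappa2bar c' D) m * conj (x.ψ (m : ZMod x.p))‖ ≤
      C * (m : ℝ) ^ (1 / 4 : ℝ) := by
  have hC0 : 0 ≤ C := by have := hC 1; simp at this; exact (norm_nonneg _).trans this
  rw [norm_mul, Complex.norm_conj]
  calc ‖(trunc (D ^ 4) (nu χ) ⍟ kappa2bar c' D) m‖ * ‖x.ψ (m : ZMod x.p)‖
      ≤ C * (m : ℝ) ^ (1 / 4 : ℝ) * 1 :=
        mul_le_mul (hC m) (x.ψ.norm_le_one _) (norm_nonneg _) (by positivity)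
    _ = C * (m : ℝ) ^ (1 / 4 : ℝ) := mul_one _

omit [NeZero D] in
/-- **The head `A_M(w,ψ)` is trivially bounded on `Re w ≥ 0`**: `‖A_M(w,ψ)‖ ≤ Σ_{m≤M}|a(m)| ≤ C·M^{5/4}`…
we only record `‖A_M(w,ψ)‖ ≤ C·M·M^{1/4}` (`|a(m)| ≤ Cm^{1/4}`, `|m^{−w}| ≤ 1`).
[cite: Zhang2022LandauSiegel, §7 p.35] -/
theorem norm_headA_le (x : Chr D) (M : ℕ) {C : ℝ}
    (hC : ∀ m : ℕ, ‖(trunc (D ^ 4) (nu χ) ⍟ kappa2bar c' D) m‖ ≤ C * (m : ℝ) ^ (1 / 4 : ℝ))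
    {w : ℂ} (hw : 0 ≤ w.re) :
    ‖∑ m ∈ Finset.Icc 1 M,
        (trunc (D ^ 4) (nu χ) ⍟ kappa2bar c' D) m * conj (x.ψ (m : ZMod x.p)) * (m : ℂ) ^ (-w)‖ ≤
      C * (M : ℝ) * (M : ℝ) ^ (1 / 4 : ℝ) := by
  have hC0 : 0 ≤ C := by have := hC 1; simp at this; exact (norm_nonneg _).trans this
  have hterm : ∀ m ∈ Finset.Icc 1 M,
      ‖(trunc (D ^ 4) (nu χ) ⍟ kappa2bar c' D) m * conj (x.ψ (m : ZMod x.p)) * (m : ℂ) ^ (-w)‖ ≤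
        C * (M : ℝ) ^ (1 / 4 : ℝ) := by
    intro m hm
    obtain ⟨h1, h2⟩ := Finset.mem_Icc.mp hm
    have hmr : (0 : ℝ) < m := by exact_mod_cast h1
    rw [norm_mul, norm_mul, Complex.norm_conj]
    have hψ : ‖x.ψ (m : ZMod x.p)‖ ≤ 1 := x.ψ.norm_le_one _
    have hc : ‖(m : ℂ) ^ (-w)‖ ≤ 1 := by
      rw [Complex.norm_natCast_cpow_of_pos h1]
      exact Real.rpow_le_one_of_one_le_of_nonpos (by exact_mod_cast h1) (by simpa using hw)
    have ha : ‖(trunc (D ^ 4) (nu χ) ⍟ kappa2bar c' D) m‖ ≤ C * (M : ℝ) ^ (1 / 4 : ℝ) :=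
      (hC m).trans (mul_le_mul_of_nonneg_left
        (Real.rpow_le_rpow hmr.le (by exact_mod_cast h2) (by norm_num)) hC0)
    calc _ ≤ C * (M : ℝ) ^ (1 / 4 : ℝ) * 1 * 1 := by gcongr
      _ = C * (M : ℝ) ^ (1 / 4 : ℝ) := by ring
  calc _ ≤ ∑ m ∈ Finset.Icc 1 M, ‖(trunc (D ^ 4) (nu χ) ⍟ kappa2bar c' D) m *
          conj (x.ψ (m : ZMod x.p)) * (m : ℂ) ^ (-w)‖ := norm_sum_le _ _
    _ ≤ ∑ m ∈ Finset.Icc 1 M, C * (M : ℝ) ^ (1 / 4 : ℝ) := Finset.sum_le_sum hterm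
    _ = C * (M : ℝ) * (M : ℝ) ^ (1 / 4 : ℝ) := by
        rw [Finset.sum_const, Nat.card_Icc, nsmul_eq_mul]; simp; ring

omit [NeZero D] in
/-- The head `A_M(·,ψ)` is entire. [cite: Zhang2022LandauSiegel, §17 u017 p.97] -/
theorem differentiable_headA (x : Chr D) (M : ℕ) :
    Differentiable ℂ fun w : ℂ => ∑ m ∈ Finset.Icc 1 M,
      (trunc (D ^ 4) (nu χ) ⍟ kappa2bar c' D) m * conj (x.ψ (m : ZMod x.p)) * (m : ℂ) ^ (-w) := by
  refine Differentiable.fun_sum fun m hm => ?_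
  have hm0 : (m : ℂ) ≠ 0 := Nat.cast_ne_zero.mpr (by have := (Finset.mem_Icc.mp hm).1; omega)
  exact (differentiable_id.neg.const_cpow (Or.inl hm0)).const_mul _

end Ratio

end Literature.NumberTheory.LFunctions.Zhang2022.Eq177

end
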